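import Summits.QuantumFields.BalabanUV.T4Continuum.Support.NE9AnalyticFixedPoint
import Literature.MathematicalPhysics.QuantumFieldTheory.Balaban1983to89.B11Prop6Scheme

/-!
# NE9Prop6SchemeBanach — THE SOLUTION OF B11's Prop. 6 ∕ (143) ∕ (158) ∕ (180) SCHEME (`B11Prop6Scheme.mapT`) IS JOINTLY
# ANALYTIC IN ANY BANACH PARAMETER ENTERING THE DATA `J`, `𝔄` AND THE OPERATORS `𝒢`, `Λ`, `W` (route R2′ «`cur` BY THREE
# DISPLAYED CONTRACTIONS» of `t4/ROUTES-NE9.md` v2 §L1.2 — contractions (C-II) [Prop. 6 (116)] and (C-III) [(175) ∕ (179)–(180)],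
# step B1⁺ ON THE PRINTED INSTANCE; companion of `NE9Contraction113Banach` for (C-I) = [II] (1.13); cell `pub-balaban`, T4-DAG §2
# node U3 ∕ §6 NE9; unit `b2b-balaban-t4-ne9-formalise-leaf-03`, generation 38; Summits-side NEW work, nothing printed asserted)

HONEST FRAMING (T4-DAG PAGE 1).  Rung (B)+1 of the FINITE-VOLUME T⁴ programme — NOT infinite volume, NOT a mass gap, NOT
the Clay problem.  NE9 (`T4OutputRate.NE9` ∧ `FadingMemory`) is a cell NEW ESTIMATE, NOT PRINTED in [I] = CMP **109**, [II] =
CMP **116**, and NOT PROVED here («NE9 ⇐ the named binders»; spine PROVED 0∕9).  HONEST DEPENDENCY (cell line, verbatim):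
continuum YM on T⁴ ⇐ BetaPertH ∧ nine spine estimates (0/9 proved); BetaPertH ⇐ (D1) ∧ (D4) ∧ CAP+tail; G-an2-4 gates asym,
D1 and NE2/3/4.  MECHANISM ONLY: NOTHING here constructs Bałaban's operators 𝔊 = 𝒢, G̃Δ^{(2)} = Λ, (δ∕δA′)V = W, H₁, H₀ or the
carriers (route R2′ step B2′ = socket C19′, FROZEN under the coordinator ruling e34b3e0c (0)); the operator bounds «Theorem 3.13 of
[5]» (‖𝒢‖ ≤ B₀), Proposition 4 (97)–(98) (the quadratic bound C₄ and analyticity of W on ‖·‖ < a₃), the θ-bound of Λ and the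
printed restrictions (118) ∕ (120)–(121) are HYPOTHESES, exactly as in `B11Prop6Scheme` (whose lemmas `mapsTo_118`, `lipschitz_120`,
`existsUnique_solution` are consumed BY NAME).

WHY THIS LEAF.  `Literature…B11Prop6Scheme` (b11-g10) types B11 Prop. 6's contraction as `mapT 𝒢 Λ W J 𝔄 X = −𝒢 J + Λ(X + 𝔄) −
𝒢(W(X + 𝔄))` (Λ = 0: (116) p. 295 with 𝔄 = H₁B, (158) p. 302; Λ = G̃Δ^{(2)}: (143) p. 300 with 𝔄 = H₀B, and the display before
(180) p. 306) and proves the analyticity clause — p. 296 *"if we replace the configuration H₁B by an arbitrary configuration 𝔄₁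
with values in the complexified Lie algebra … the solution is an analytic function of 𝔄₁"* — in ONE complex parameter
(`solution_analytic`, `σ ∈ V ⊆ ℂ`, constant operators) and along complex LINES in 𝔄 (`solution_analytic_line`).  Route R2′ needs
the solution as ONE analytic map of Banach data: 𝒜₁ as a function of 𝔄₁ = H₁B with B a 𝔤^c-valued configuration (p. 306 *"𝒜₁, as a
solution of Eq. (175), is an analytic function of H₁B, hence of B"*), and, for [II] (1.15)–(1.16) (*"the solution of Eq. (1.4) is
an analytic function of B′, s(Y₀)"*) and p. 287 ∕ pp. 306–307 (*"analytic function of U₀"*, *"analytic function of V"*), with the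
OPERATORS themselves depending analytically on the parameter (s(Y₀) enters through G̃(s), H(s), H₀(s)).  This leaf proves
exactly that, for any complex Banach parameter and parameter-dependent `𝒢`, `Λ`, `W`, `J`, `𝔄`.

WHAT THIS LEAF PROVES (kernel; [folklore] mechanism over abstract complex Banach spaces `𝒴`, `𝒵`, parameter space `Ξ`).
`exists_analyticOnNhd_solution_mapT`: on an open `V ⊆ Ξ` let `ξ ↦ 𝒢_ξ, Λ_ξ, J_ξ, 𝔄_ξ` be analytic and `(ξ, Y) ↦ W_ξ Y` jointly
analytic on `V ×ˢ {‖Y‖ < a₃}`, with the scheme's bounds UNIFORM on `V` (`‖𝒢_ξ f‖ ≤ B₀‖f‖`, `‖Λ_ξ Y‖ ≤ θ‖Y‖`, `‖W_ξ Y‖ ≤ C₄‖Y‖²` on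
`‖Y‖ < a₃`, `‖J_ξ‖ ≤ j`, `‖𝔄_ξ‖ < a`) and the printed-type restrictions `2(ε₄ + a) ≤ a₃` ((120): *"to be able to apply Proposition
4"*), `B₀j + θ(ε₄ + a) + B₀C₄(ε₄ + a)² ≤ ε₄` ((118)), `θ + 4B₀C₄(ε₄ + a) < 1` ((120)–(121)).  Then the unique solution `X(ξ)` of
`mapT 𝒢_ξ Λ_ξ W_ξ J_ξ 𝔄_ξ X = X` in `‖X‖ ≤ ε₄` (B11's `existsUnique_solution`) is `AnalyticOnNhd ℂ` on `V`.  Corollaries: `…_of_const`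
(constant operators — B11's `solution_analytic` with `ℂ` replaced by any Banach `Ξ`), and the (115)∕(1.16)-type range clauses stay
available BY NAME on `X(ξ)` (`B11Prop6Scheme.norm_solution_le`, `solution_mem_of_invariant`).  MECHANISM: the fixed ball `‖X‖ ≤ ε₄`
has no uniform room `r < r′` under (120) as printed, so the proof LOCALISES: near `ξ₀` the slack `δ = (a − ‖𝔄_{ξ₀}‖)∕2` of the strict
datum bound is traded for X-room (`lipschitz_120` at `(a − δ, ε₄ + δ)`, same constant), `NE9AnalyticFixedPoint.exists_contDiffOn_
fixedPt_section` (`n = ω`) runs on `V ∩ {‖𝔄_ξ‖ < a − δ}`, and uniqueness in `‖X‖ ≤ ε₄` glues the local sections to the global one.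
HONEST CAVEAT (typing): as in `B11Prop6Scheme.Prop4Hyp`, W's analyticity is FRÉCHET (here jointly with the parameter); B13's
line-analytic `QuadAnalytic` is derived, never assumed weaker; no Hartogs-type bridge is used or claimed.  DISGUISE TEST: Banach's fixed
point + the implicit function theorem (via `NE9AnalyticFixedPoint`) + B11Prop6Scheme's printed-scheme lemmas; no inequality of the
series is proved; not NE9; 0 def, 0 sorry.

References (TYPES ∕ loci only): [Balaban1985Variational] T. Bałaban, CMP **102** (1985) 277–309, Sect. E Prop. 6 (111)–(121)
pp. 294–296, (143) p. 300, (158) p. 302, Sect. G (171)–(181) pp. 305–307; [Balaban1988RG2Cluster] T. Bałaban, CMP **116** (1988)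
1–22, p. 6 (1.15)–(1.16); S.-N. Chow, J. K. Hale, *Methods of Bifurcation Theory* (1982) §2.2 [folklore].  Imports
`NE9AnalyticFixedPoint` + `B11Prop6Scheme` ONLY; modifies nothing.  Value = route-R2′ kernel on the tree's own typing of Prop. 6,
NOT summit progress.
-/

noncomputable section

open scoped Topology NNReal ContDiff
open Metric Set Filter Function

namespace Summit.QuantumFields.BalabanUV.T4Continuum.NE9Prop6SchemeBanach

open Literature.MathematicalPhysics.QuantumFieldTheory.Balaban1983to89.B13Contraction113 (QuadAnalytic)
open Literature.MathematicalPhysics.QuantumFieldTheory.Balaban1983to89.B11Prop6Scheme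
open Summit.QuantumFields.BalabanUV.T4Continuum.NE9AnalyticFixedPoint

variable {Ξ : Type*} [NormedAddCommGroup Ξ] [NormedSpace ℂ Ξ] [CompleteSpace Ξ]
  {𝒴 : Type*} [NormedAddCommGroup 𝒴] [NormedSpace ℂ 𝒴] [CompleteSpace 𝒴]
  {𝒵 : Type*} [NormedAddCommGroup 𝒵] [NormedSpace ℂ 𝒵]

omit [CompleteSpace Ξ] [CompleteSpace 𝒴] in
/-- [folklore] A jointly analytic `(ξ, Y) ↦ W_ξ Y` on `V ×ˢ {‖Y‖ < a₃}` with the quadratic bound gives B11's Fréchet hypothesis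
structure `Prop4Hyp (W ξ) C₄ a₃` at every `ξ ∈ V` (slice of an analytic map). -/
theorem prop4Hyp_slice {W : Ξ → 𝒴 → 𝒵} {C₄ a₃ : ℝ} {V : Set Ξ}
    (hWa : AnalyticOnNhd ℂ (fun q : Ξ × 𝒴 => W q.1 q.2) (V ×ˢ {Y : 𝒴 | ‖Y‖ < a₃}))
    (hWq : ∀ ξ ∈ V, ∀ Y : 𝒴, ‖Y‖ < a₃ → ‖W ξ Y‖ ≤ C₄ * ‖Y‖ ^ 2) {ξ : Ξ} (hξ : ξ ∈ V) :
    Prop4Hyp (W ξ) C₄ a₃ where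
  quad := hWq ξ hξ
  differentiableOn :=
    (hWa.comp₂ analyticOnNhd_const analyticOnNhd_id (fun _ hY => ⟨hξ, hY⟩)).differentiableOn

/-- [folklore] **THE SOLUTION OF THE Prop. 6 SCHEME IS JOINTLY ANALYTIC IN A BANACH PARAMETER ENTERING ALL THE DATA.**  Let
`V ⊆ Ξ` be open; `ξ ↦ 𝒢_ξ : 𝒵 →L[ℂ] 𝒴`, `ξ ↦ Λ_ξ : 𝒴 →L[ℂ] 𝒴`, `ξ ↦ J_ξ : 𝒵`, `ξ ↦ 𝔄_ξ : 𝒴` analytic on `V`; `(ξ, Y) ↦ W_ξ Y`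
analytic on `V ×ˢ {‖Y‖ < a₃}`; bounds uniform on `V`: `‖𝒢_ξ f‖ ≤ B₀‖f‖` (*"Theorem 3.13 of [5]"*), `‖Λ_ξ Y‖ ≤ θ‖Y‖`, `‖W_ξ Y‖ ≤ C₄‖Y‖²`
for `‖Y‖ < a₃` (Prop. 4 (98)), `‖J_ξ‖ ≤ j`, `‖𝔄_ξ‖ < a`; and the restrictions `0 ≤ ε₄`, `2(ε₄ + a) ≤ a₃`,
`B₀j + θ(ε₄ + a) + B₀C₄(ε₄ + a)² ≤ ε₄` ((118)), `θ + 4B₀C₄(ε₄ + a) < 1` ((120)–(121)).  Then there is `Xs : Ξ → 𝒴`, ANALYTIC on `V`,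
with `‖Xs ξ‖ ≤ ε₄`, `mapT 𝒢_ξ Λ_ξ W_ξ J_ξ 𝔄_ξ (Xs ξ) = Xs ξ`, and every solution in `‖X‖ ≤ ε₄` equals `Xs ξ` — p. 296 *"the solution
is an analytic function of 𝔄₁"*, p. 306 *"analytic function of H₁B, hence of B"*, [II] p. 6 *"analytic function of B′, s(Y₀)"*, with
ALL of them (and the operators' own parameter) at once. -/
theorem exists_analyticOnNhd_solution_mapT {𝒢 : Ξ → (𝒵 →L[ℂ] 𝒴)} {Λ : Ξ → (𝒴 →L[ℂ] 𝒴)} {W : Ξ → 𝒴 → 𝒵}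
    {J : Ξ → 𝒵} {𝔄 : Ξ → 𝒴} {B₀ θ C₄ a₃ j a ε₄ : ℝ} {V : Set Ξ} (hV : IsOpen V)
    (h𝒢a : AnalyticOnNhd ℂ 𝒢 V) (hΛa : AnalyticOnNhd ℂ Λ V)
    (hWa : AnalyticOnNhd ℂ (fun q : Ξ × 𝒴 => W q.1 q.2) (V ×ˢ {Y : 𝒴 | ‖Y‖ < a₃}))
    (hJa : AnalyticOnNhd ℂ J V) (h𝔄a : AnalyticOnNhd ℂ 𝔄 V)
    (h𝒢 : ∀ ξ ∈ V, ∀ f, ‖𝒢 ξ f‖ ≤ B₀ * ‖f‖) (hΛ : ∀ ξ ∈ V, ∀ Y, ‖Λ ξ Y‖ ≤ θ * ‖Y‖)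
    (hWq : ∀ ξ ∈ V, ∀ Y : 𝒴, ‖Y‖ < a₃ → ‖W ξ Y‖ ≤ C₄ * ‖Y‖ ^ 2)
    (hB₀ : 0 ≤ B₀) (hC₄ : 0 ≤ C₄) (hθ : 0 ≤ θ) (hJ : ∀ ξ ∈ V, ‖J ξ‖ ≤ j) (h𝔄 : ∀ ξ ∈ V, ‖𝔄 ξ‖ < a)
    (hε₄ : 0 ≤ ε₄) (hdom : 2 * (ε₄ + a) ≤ a₃)
    (hself : B₀ * j + θ * (ε₄ + a) + B₀ * C₄ * (ε₄ + a) ^ 2 ≤ ε₄) (hcontr : θ + 4 * B₀ * C₄ * (ε₄ + a) < 1) :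
    ∃ Xs : Ξ → 𝒴, AnalyticOnNhd ℂ Xs V ∧ ∀ ξ ∈ V,
      ‖Xs ξ‖ ≤ ε₄ ∧ mapT (𝒢 ξ) (Λ ξ) (W ξ) (J ξ) (𝔄 ξ) (Xs ξ) = Xs ξ ∧
      ∀ X' : 𝒴, ‖X'‖ ≤ ε₄ → mapT (𝒢 ξ) (Λ ξ) (W ξ) (J ξ) (𝔄 ξ) X' = X' → X' = Xs ξ := by
  -- the family and its global (pointwise) unique solution
  set T : Ξ → 𝒴 → 𝒴 := fun ξ X => mapT (𝒢 ξ) (Λ ξ) (W ξ) (J ξ) (𝔄 ξ) X with hT_def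
  have hP4 : ∀ ξ ∈ V, Prop4Hyp (W ξ) C₄ a₃ := fun ξ hξ => prop4Hyp_slice hWa hWq hξ
  have hsol : ∀ ξ ∈ V, ∃! X : 𝒴, ‖X‖ ≤ ε₄ ∧ T ξ X = X := fun ξ hξ =>
    existsUnique_solution (h𝒢 ξ hξ) (hΛ ξ hξ) (hP4 ξ hξ).quadAnalytic hB₀ hC₄ hθ (hJ ξ hξ) (h𝔄 ξ hξ) hε₄ hdom
      hself hcontr
  choose! Xs hXs hXu using hsol
  refine ⟨Xs, fun ξ₀ hξ₀ => ?_, fun ξ hξ => ⟨(hXs ξ hξ).1, (hXs ξ hξ).2, fun X' hX' hfix' => hXu ξ hξ X' ⟨hX', hfix'⟩⟩⟩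
  -- ANALYTICITY AT `ξ₀ ∈ V`: localise to `V₀ = V ∩ {‖𝔄 ξ‖ < a − δ}`, `δ = (a − ‖𝔄 ξ₀‖)/2`
  have ha : 0 < a := (norm_nonneg _).trans_lt (h𝔄 ξ₀ hξ₀)
  have hdom1 : ε₄ + a ≤ a₃ := by linarith
  set δ : ℝ := (a - ‖𝔄 ξ₀‖) / 2 with hδ_def
  have hδ : 0 < δ := by have := h𝔄 ξ₀ hξ₀; rw [hδ_def]; linarith
  have hδa : ‖𝔄 ξ₀‖ < a - δ := by rw [hδ_def]; linarith [h𝔄 ξ₀ hξ₀]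
  set V₀ : Set Ξ := V ∩ 𝔄 ⁻¹' ball (0:𝒴) (a - δ) with hV₀_def
  have hV₀ : IsOpen V₀ := h𝔄a.continuousOn.isOpen_inter_preimage hV isOpen_ball
  have hξ₀V₀ : ξ₀ ∈ V₀ := ⟨hξ₀, mem_ball_zero_iff.mpr hδa⟩
  have hV₀V : V₀ ⊆ V := inter_subset_left
  have h𝔄' : ∀ ξ ∈ V₀, ‖𝔄 ξ‖ < a - δ := fun ξ hξ => mem_ball_zero_iff.mp hξ.2
  -- the uniform-contraction data on `V₀` with X-room `ε₄ < ε₄ + δ`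
  have hK0 : 0 ≤ θ + 4 * B₀ * C₄ * (ε₄ + a) := by positivity
  set K : ℝ≥0 := ⟨θ + 4 * B₀ * C₄ * (ε₄ + a), hK0⟩ with hK_def
  have hK : (K : ℝ) < 1 := hcontr
  have hmaps : ∀ ξ ∈ V₀, MapsTo (T ξ) (closedBall (0:𝒴) ε₄) (closedBall (0:𝒴) ε₄) := by
    intro ξ hξ X hX
    rw [mem_closedBall_zero_iff] at hX ⊢
    exact mapsTo_118 (h𝒢 ξ (hV₀V hξ)) (hΛ ξ (hV₀V hξ)) (hP4 ξ (hV₀V hξ)).quadAnalytic hB₀ hC₄ hθ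
      (hJ ξ (hV₀V hξ)) (h𝔄 ξ (hV₀V hξ)) hdom1 hself X hX
  have hlip : ∀ ξ ∈ V₀, LipschitzOnWith K (T ξ) (ball (0:𝒴) (ε₄ + δ)) := by
    intro ξ hξ
    refine LipschitzOnWith.of_dist_le_mul fun X hX Y hY => ?_
    rw [dist_eq_norm, dist_eq_norm]
    have hdom' : 2 * ((ε₄ + δ) + (a - δ)) ≤ a₃ := by linarith
    have h := lipschitz_120 (J := J ξ) (h𝒢 ξ (hV₀V hξ)) (hΛ ξ (hV₀V hξ)) (hP4 ξ (hV₀V hξ)).quadAnalytic hB₀ hC₄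
      (h𝔄' ξ hξ) (by linarith : (0:ℝ) ≤ ε₄ + δ) hdom' (mem_ball_zero_iff.mp hX).le (mem_ball_zero_iff.mp hY).le
    have e : (ε₄ + δ) + (a - δ) = ε₄ + a := by ring
    rw [e] at h
    exact h
  -- joint analyticity of `(ξ, X) ↦ T ξ X` on `V₀ ×ˢ ball 0 (ε₄ + δ)`
  set S : Set (Ξ × 𝒴) := V₀ ×ˢ ball (0:𝒴) (ε₄ + δ) with hS_def
  have hfst : MapsTo (fun q : Ξ × 𝒴 => q.1) S V := fun q hq => hV₀V hq.1
  have hVu : UniqueDiffOn ℂ V := hV.uniqueDiffOn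
  have hWo : IsOpen (V ×ˢ {Y : 𝒴 | ‖Y‖ < a₃}) := hV.prod (isOpen_lt continuous_norm continuous_const)
  have c𝒢 : ContDiffOn ℂ ω (fun q : Ξ × 𝒴 => 𝒢 q.1) S := (h𝒢a.contDiffOn hVu).comp contDiffOn_fst hfst
  have cΛ : ContDiffOn ℂ ω (fun q : Ξ × 𝒴 => Λ q.1) S := (hΛa.contDiffOn hVu).comp contDiffOn_fst hfst
  have cJ : ContDiffOn ℂ ω (fun q : Ξ × 𝒴 => J q.1) S := (hJa.contDiffOn hVu).comp contDiffOn_fst hfst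
  have c𝔄 : ContDiffOn ℂ ω (fun q : Ξ × 𝒴 => 𝔄 q.1) S := (h𝔄a.contDiffOn hVu).comp contDiffOn_fst hfst
  have cin : ContDiffOn ℂ ω (fun q : Ξ × 𝒴 => q.2 + 𝔄 q.1) S := contDiffOn_snd.add c𝔄
  have hin : MapsTo (fun q : Ξ × 𝒴 => (q.1, q.2 + 𝔄 q.1)) S (V ×ˢ {Y : 𝒴 | ‖Y‖ < a₃}) := by
    intro q hq
    refine ⟨hV₀V hq.1, ?_⟩
    have h1 : ‖q.2‖ < ε₄ + δ := mem_ball_zero_iff.mp hq.2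
    have h2 : ‖𝔄 q.1‖ < a - δ := h𝔄' q.1 hq.1
    show ‖q.2 + 𝔄 q.1‖ < a₃
    calc ‖q.2 + 𝔄 q.1‖ ≤ ‖q.2‖ + ‖𝔄 q.1‖ := norm_add_le _ _
      _ < (ε₄ + δ) + (a - δ) := add_lt_add h1 h2
      _ = ε₄ + a := by ring
      _ ≤ a₃ := by linarith
  have cW : ContDiffOn ℂ ω (fun q : Ξ × 𝒴 => W q.1 (q.2 + 𝔄 q.1)) S :=
    (hWa.contDiffOn hWo.uniqueDiffOn).comp (contDiffOn_fst.prodMk cin) hin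
  have hT : ContDiffOn ℂ ω (fun q : Ξ × 𝒴 => T q.1 q.2) S := by
    show ContDiffOn ℂ ω (fun q : Ξ × 𝒴 => -(𝒢 q.1) (J q.1) + (Λ q.1) (q.2 + 𝔄 q.1) - (𝒢 q.1) (W q.1 (q.2 + 𝔄 q.1))) S
    exact ((c𝒢.clm_apply cJ).neg.add (cΛ.clm_apply cin)).sub (c𝒢.clm_apply cW)
  -- the analytic local section on `V₀`, and gluing by uniqueness in `‖X‖ ≤ ε₄`
  have hω : (ω : ℕ∞ω) ≠ 0 := by simp
  obtain ⟨x₀, hx₀s, hx₀fix, -, -⟩ :=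
    exists_contDiffOn_fixedPt_section T hV₀ hε₄ (by linarith : ε₄ < ε₄ + δ) hK hω hmaps hlip hT
  have hagree : ∀ ξ ∈ V₀, x₀ ξ = Xs ξ := fun ξ hξ =>
    hXu ξ (hV₀V hξ) (x₀ ξ) ⟨mem_closedBall_zero_iff.mp (hx₀fix ξ hξ).1, (hx₀fix ξ hξ).2⟩
  have hx₀a : AnalyticAt ℂ x₀ ξ₀ := ((hx₀s ξ₀ hξ₀V₀).contDiffAt (hV₀.mem_nhds hξ₀V₀)).analyticAt
  refine hx₀a.congr ?_
  filter_upwards [hV₀.mem_nhds hξ₀V₀] with ξ hξ using hagree ξ hξ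

/-- [folklore] **CONSTANT OPERATORS** — B11's `solution_analytic` with the parameter line `ℂ` replaced by any complex Banach space
`Ξ`: for fixed `𝒢`, `Λ` and a fixed `W` with the quadratic bound and ANALYTIC on `‖Y‖ < a₃` (Prop. 4 p. 292 *"The functional
derivative of V(A′) is an analytic function on this space, and satisfies the estimate … (98)"*; Fréchet-analytic — on the cell's
finite-dimensional carriers the same as `Prop4Hyp`'s `DifferentiableOn ℂ`, which it implies), and analytic data `ξ ↦ (J_ξ, 𝔄_ξ)` on
an open `V` with `‖J_ξ‖ ≤ j`, `‖𝔄_ξ‖ < a`, under the scheme's restrictions, the unique solution in `‖X‖ ≤ ε₄` is analytic on `V`.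
Covers Prop. 6's *"analytic function of 𝔄₁"* for a 𝔤^c-valued Banach variable `𝔄₁` (take `Ξ := 𝒴`, `𝔄_ξ := ξ`, `V := ball 0 a`,
`J` constant) and (180)'s analyticity in `B` through `𝔄 = H₀B` (`𝔄 := H₀ ∘ (·)`, linear hence analytic). -/
theorem exists_analyticOnNhd_solution_mapT_of_const {𝒢 : 𝒵 →L[ℂ] 𝒴} {Λ : 𝒴 →L[ℂ] 𝒴} {W : 𝒴 → 𝒵}
    {J : Ξ → 𝒵} {𝔄 : Ξ → 𝒴} {B₀ θ C₄ a₃ j a ε₄ : ℝ} {V : Set Ξ} (hV : IsOpen V)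
    (h𝒢 : ∀ f, ‖𝒢 f‖ ≤ B₀ * ‖f‖) (hΛ : ∀ Y, ‖Λ Y‖ ≤ θ * ‖Y‖)
    (hWq : ∀ Y : 𝒴, ‖Y‖ < a₃ → ‖W Y‖ ≤ C₄ * ‖Y‖ ^ 2) (hWa : AnalyticOnNhd ℂ W {Y : 𝒴 | ‖Y‖ < a₃})
    (hJa : AnalyticOnNhd ℂ J V) (h𝔄a : AnalyticOnNhd ℂ 𝔄 V)
    (hB₀ : 0 ≤ B₀) (hC₄ : 0 ≤ C₄) (hθ : 0 ≤ θ) (hJ : ∀ ξ ∈ V, ‖J ξ‖ ≤ j) (h𝔄 : ∀ ξ ∈ V, ‖𝔄 ξ‖ < a)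
    (hε₄ : 0 ≤ ε₄) (hdom : 2 * (ε₄ + a) ≤ a₃)
    (hself : B₀ * j + θ * (ε₄ + a) + B₀ * C₄ * (ε₄ + a) ^ 2 ≤ ε₄) (hcontr : θ + 4 * B₀ * C₄ * (ε₄ + a) < 1) :
    ∃ Xs : Ξ → 𝒴, AnalyticOnNhd ℂ Xs V ∧ ∀ ξ ∈ V,
      ‖Xs ξ‖ ≤ ε₄ ∧ mapT 𝒢 Λ W (J ξ) (𝔄 ξ) (Xs ξ) = Xs ξ ∧
      ∀ X' : 𝒴, ‖X'‖ ≤ ε₄ → mapT 𝒢 Λ W (J ξ) (𝔄 ξ) X' = X' → X' = Xs ξ := by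
  have hWa' : AnalyticOnNhd ℂ (fun q : Ξ × 𝒴 => W q.2) (V ×ˢ {Y : 𝒴 | ‖Y‖ < a₃}) :=
    hWa.comp analyticOnNhd_snd (fun q hq => hq.2)
  exact exists_analyticOnNhd_solution_mapT (𝒢 := fun _ => 𝒢) (Λ := fun _ => Λ) (W := fun _ Y => W Y) hV
    analyticOnNhd_const analyticOnNhd_const hWa' hJa h𝔄a (fun _ _ => h𝒢) (fun _ _ => hΛ) (fun _ _ => hWq)
    hB₀ hC₄ hθ hJ h𝔄 hε₄ hdom hself hcontr

omit [CompleteSpace 𝒴] in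
/-- The solution of `exists_analyticOnNhd_solution_mapT_of_const` is B11's: at each `ξ ∈ V` it is the unique solution of
`B11Prop6Scheme.existsUnique_solution` (so `norm_solution_le` ∕ `solution_mem_of_invariant` ∕ `prop6_solution`'s clauses apply to
it BY NAME), and B11's `Prop4Hyp` follows from the analytic hypothesis. [folklore] -/
theorem prop4Hyp_of_analyticOnNhd {W : 𝒴 → 𝒵} {C₄ a₃ : ℝ}
    (hWq : ∀ Y : 𝒴, ‖Y‖ < a₃ → ‖W Y‖ ≤ C₄ * ‖Y‖ ^ 2) (hWa : AnalyticOnNhd ℂ W {Y : 𝒴 | ‖Y‖ < a₃}) :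
    Prop4Hyp W C₄ a₃ :=
  ⟨hWq, hWa.differentiableOn⟩

end Summit.QuantumFields.BalabanUV.T4Continuum.NE9Prop6SchemeBanach

end
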